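import Mathlib
import Summits.Ventures.PercRepro2.Defs
import Summits.Ventures.PercRepro2.Independence
import Summits.Ventures.PercRepro2.Graph
import Summits.Ventures.PercRepro2.Induced
import Summits.Ventures.PercRepro2.HullDefs

/-!
# The split-root functional with adjacent roots is the average of two (BASE) functionals
(blind cell PercRepro2, mine-2 g10; `proofs/MINE2-CUTVERTEX.md` §8.3 (I1))

On the free fibre write, for roots `l, h` and marks `o, b`,
`Φ(l) := Σ_ζ 1[h ∉ C_R(l) ∪ C_B(l)] · (1[o ∈ C_R(l)] − 1[o ∈ C_B(l)]) · (1[b ∈ C_B(h)] − 1[b ∈ C_R(h)])`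
(`phiSum`; (BASE) is `Φ ≥ 0`), and the SPLIT-ROOT functional with a red root `u` and a blue root `v`
`Φ_split(u, v) := Σ_ζ 1[h ∉ C_R(u), h ∉ C_B(v)] · (1[o ∈ C_R(u)] − 1[o ∈ C_B(v)]) · (1[b ∈ C_B(h)] − 1[b ∈ C_R(h)])`
(`splitSum`). It arises when a root of degree 2 with neighbours `u, v` is removed (state red–blue).

**Theorem** (`two_mul_splitSum`): if `u ~ v` via an edge `g`, then `2 · Φ_split(u, v) = Φ(u) + Φ(v)`.
Proof: when `g` is red, `C_R(u) = C_R(v)` and the split summand is the `Φ(v)`-summand; when `g` is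
blue, `C_B(u) = C_B(v)` and it is the `Φ(u)`-summand; and the colour swap `ζ ↦ blue ζ` exchanges
`{g red}` and `{g blue}` while fixing every summand (`Q̂` is swap-invariant, both signs change sign).
Hence Φ_split ≥ 0 whenever (BASE) holds at the two roots — without adjacency the split functional can
be negative (33,994 / 336,000 instances at n = 6; with adjacent roots 0 / 190,200).
-/

namespace Summit.Ventures.PercRepro2

namespace SplitRoot

open Hull

variable {V : Type*} {E : Type*}
variable (R : Type*) [CommRing R]

open scoped Classical

/-- The sign of `o` relative to the red root `u` and the blue root `v`:
`1[o ∈ C_R(u)] − 1[o ∈ C_B(v)]`. -/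
noncomputable def osign (ends : E → Sym2 V) (ζ : Config E) (u v o : V) : R :=
  (if o ∈ cluster ends ζ u then 1 else 0) - (if o ∈ cluster ends (blue ζ) v then 1 else 0)

/-- The sign of `b` relative to `h`: `1[b ∈ C_B(h)] − 1[b ∈ C_R(h)]`. -/
noncomputable def bsign (ends : E → Sym2 V) (ζ : Config E) (h b : V) : R :=
  (if b ∈ cluster ends (blue ζ) h then 1 else 0) - (if b ∈ cluster ends ζ h then 1 else 0)

/-- The split-root summand: `1[h ∉ C_R(u), h ∉ C_B(v)] · osign · bsign`. -/
noncomputable def splitTerm (ends : E → Sym2 V) (ζ : Config E) (u v h o b : V) : R :=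
  (if h ∉ cluster ends ζ u ∧ h ∉ cluster ends (blue ζ) v then 1 else 0) *
    osign R ends ζ u v o * bsign R ends ζ h b

variable {R}

/-! ## Clusters along an edge of the given colour -/

/-- Clusters are equivalence classes: `v ∈ C(u)` gives `C(v) = C(u)`. -/
lemma cluster_eq_of_mem {ends : E → Sym2 V} {ω : Config E} {u v : V}
    (h : v ∈ cluster ends ω u) : cluster ends ω v = cluster ends ω u := by
  ext x
  simp only [mem_cluster] at h ⊢
  exact ⟨fun hx => conn_trans h hx, fun hx => conn_trans (conn_symm h) hx⟩

/-- A red edge `g = uv` identifies the red clusters of `u` and `v`. -/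
lemma cluster_eq_of_red {ends : E → Sym2 V} {ζ : Config E} {g : E} {u v : V}
    (hg : ends g = s(u, v)) (hred : ζ g = true) : cluster ends ζ v = cluster ends ζ u :=
  cluster_eq_of_mem (mem_cluster_of_edge (mem_cluster_self ends ζ u) hred hg)

/-- A blue edge `g = uv` identifies the blue clusters of `u` and `v`. -/
lemma cluster_blue_eq_of_blue {ends : E → Sym2 V} {ζ : Config E} {g : E} {u v : V}
    (hg : ends g = s(u, v)) (hblue : ζ g = false) :
    cluster ends (blue ζ) v = cluster ends (blue ζ) u :=
  cluster_eq_of_mem (mem_cluster_of_edge (mem_cluster_self ends (blue ζ) u)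
    (blue_eq_true_iff.2 hblue) hg)

/-- On `{g red}` the split summand is the `Φ(v)`-summand. -/
lemma splitTerm_eq_of_red {ends : E → Sym2 V} {ζ : Config E} {g : E} {u v : V} (h o b : V)
    (hg : ends g = s(u, v)) (hred : ζ g = true) :
    splitTerm R ends ζ u v h o b = splitTerm R ends ζ v v h o b := by
  simp only [splitTerm, osign, cluster_eq_of_red hg hred]

/-- On `{g blue}` the split summand is the `Φ(u)`-summand. -/
lemma splitTerm_eq_of_blue {ends : E → Sym2 V} {ζ : Config E} {g : E} {u v : V} (h o b : V)
    (hg : ends g = s(u, v)) (hblue : ζ g = false) :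
    splitTerm R ends ζ u v h o b = splitTerm R ends ζ u u h o b := by
  simp only [splitTerm, osign, cluster_blue_eq_of_blue hg hblue]

/-! ## The colour swap fixes every (BASE) summand -/

/-- The (BASE) summand is invariant under the colour swap. -/
lemma splitTerm_blue (ends : E → Sym2 V) (ζ : Config E) (l h o b : V) :
    splitTerm R ends (blue ζ) l l h o b = splitTerm R ends ζ l l h o b := by
  simp only [splitTerm, osign, bsign, blue_blue]
  by_cases h1 : h ∉ cluster ends ζ l ∧ h ∉ cluster ends (blue ζ) l
  · rw [if_pos h1, if_pos ⟨h1.2, h1.1⟩]; ring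
  · rw [if_neg h1, if_neg (fun h2 => h1 ⟨h2.2, h2.1⟩)]; simp

variable [Fintype E]

variable (R) in
/-- `Φ_split(u, v)`. -/
noncomputable def splitSum (ends : E → Sym2 V) (u v h o b : V) : R :=
  ∑ ζ : Config E, splitTerm R ends ζ u v h o b

variable (R) in
/-- The (BASE) functional `Φ(l) = Φ_split(l, l)`. -/
noncomputable def phiSum (ends : E → Sym2 V) (l h o b : V) : R :=
  splitSum R ends l l h o b

/-- A sum of a swap-invariant function over `{g red}` equals the sum over `{g blue}`. -/
lemma sum_red_eq_sum_blue (g : E) (F : Config E → R) (hF : ∀ ζ, F (blue ζ) = F ζ) :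
    ∑ ζ ∈ Finset.univ.filter (fun ζ : Config E => ζ g = true), F ζ =
      ∑ ζ ∈ Finset.univ.filter (fun ζ : Config E => ¬ ζ g = true), F ζ := by
  refine Finset.sum_nbij' blue blue ?_ ?_ ?_ ?_ ?_
  · intro ζ hζ
    simp only [Finset.mem_filter, Finset.mem_univ, true_and] at hζ ⊢
    simp [blue_apply, hζ]
  · intro ζ hζ
    simp only [Finset.mem_filter, Finset.mem_univ, true_and, Bool.not_eq_true] at hζ ⊢
    simp [blue_apply, hζ]
  · intro ζ _; exact blue_blue ζ
  · intro ζ _; exact blue_blue ζ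
  · intro ζ _; exact (hF ζ).symm

/-- A swap-invariant function has half its total sum on `{g red}`. -/
lemma two_mul_sum_red (g : E) (F : Config E → R) (hF : ∀ ζ, F (blue ζ) = F ζ) :
    2 * ∑ ζ ∈ Finset.univ.filter (fun ζ : Config E => ζ g = true), F ζ = ∑ ζ, F ζ := by
  rw [two_mul]
  nth_rewrite 2 [sum_red_eq_sum_blue g F hF]
  exact Finset.sum_filter_add_sum_filter_not _ _ _

/-! ## The identity -/

/-- **Split roots along an edge**: `2 · Φ_split(u, v) = Φ(u) + Φ(v)` whenever `g = uv` is an edge. -/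
theorem two_mul_splitSum (ends : E → Sym2 V) {g : E} {u v : V} (hg : ends g = s(u, v))
    (h o b : V) :
    2 * splitSum R ends u v h o b = phiSum R ends u h o b + phiSum R ends v h o b := by
  unfold splitSum phiSum
  -- split the sum by the colour of `g`
  rw [← Finset.sum_filter_add_sum_filter_not Finset.univ (fun ζ : Config E => ζ g = true)]
  have hred : ∑ ζ ∈ Finset.univ.filter (fun ζ : Config E => ζ g = true),
      splitTerm R ends ζ u v h o b =
      ∑ ζ ∈ Finset.univ.filter (fun ζ : Config E => ζ g = true), splitTerm R ends ζ v v h o b := by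
    refine Finset.sum_congr rfl fun ζ hζ => ?_
    simp only [Finset.mem_filter, Finset.mem_univ, true_and] at hζ
    exact splitTerm_eq_of_red h o b hg hζ
  have hblue : ∑ ζ ∈ Finset.univ.filter (fun ζ : Config E => ¬ ζ g = true),
      splitTerm R ends ζ u v h o b =
      ∑ ζ ∈ Finset.univ.filter (fun ζ : Config E => ¬ ζ g = true), splitTerm R ends ζ u u h o b := by
    refine Finset.sum_congr rfl fun ζ hζ => ?_
    simp only [Finset.mem_filter, Finset.mem_univ, true_and, Bool.not_eq_true] at hζ
    exact splitTerm_eq_of_blue h o b hg hζ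
  rw [hred, hblue, mul_add]
  have hv := two_mul_sum_red g (fun ζ => splitTerm R ends ζ v v h o b)
    (fun ζ => splitTerm_blue ends ζ v h o b)
  have hu := two_mul_sum_red g (fun ζ => splitTerm R ends ζ u u h o b)
    (fun ζ => splitTerm_blue ends ζ u h o b)
  rw [hv, ← sum_red_eq_sum_blue g (fun ζ => splitTerm R ends ζ u u h o b)
    (fun ζ => splitTerm_blue ends ζ u h o b), hu, add_comm]
  rfl

/-- The split functional with adjacent roots is nonnegative as soon as (BASE) holds at both roots. -/
theorem splitSum_nonneg [LinearOrder R] [IsStrictOrderedRing R] (ends : E → Sym2 V) {g : E}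
    {u v : V} (hg : ends g = s(u, v)) (h o b : V) (hu : 0 ≤ phiSum R ends u h o b)
    (hv : 0 ≤ phiSum R ends v h o b) : 0 ≤ splitSum R ends u v h o b := by
  have h2 : (2 : R) * 0 ≤ 2 * splitSum R ends u v h o b := by
    rw [mul_zero, two_mul_splitSum ends hg h o b]; exact add_nonneg hu hv
  exact le_of_mul_le_mul_left h2 (by norm_num)

end SplitRoot

end Summit.Ventures.PercRepro2
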